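import Summits.Parity.GeneralizedHardyLittlewood.Theses.FordMaynardNoSieveConst0164
import Literature.NumberTheory.Sieve.FordMaynardTweak
import HarnessLib

/-!
# BC3 birth skeleton — crux `NegWitness0164` (rank 2) of route `FordMaynardNoSieveConst0164`
(Parity / GeneralizedHardyLittlewood; item stmt-Parity-19102)

REFRESH (line-writer seat `linewriter-parity-certcluster-1` g0, 2026-08-31) of the pre-open birth skeleton
`pub/parity-ideate/parity-ideate-p3/bc/NegWitness0164_birth.lean` (sha16 6a9c261b324481eb): the local crux `def` is
replaced by the ROUTE DECL `Summit.Parity.GeneralizedHardyLittlewood.Theses.FordMaynardNoSieveConst0164.NegWitness0164`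
(imported), so that `NegWitness0164_of` concludes the crux BY NAME; the one open stub is unchanged in content.

LINE.  `NegWitness0164 = TypeIStarNegWitness (41/250) (1/2)` (some `f ∈ 𝔉*_η(γ)`, `η = 41/250`, `γ = 1/2`, with
`f(1) < −1` and `f ≥ −1` in every dimension `≥ 2`)  ⇐  `stub_tweakNeg0164` = the CERTIFICATE on RAW simplex step
data `F₀` (symmetric, piecewise Lipschitz, supported on `{all ξᵢ ≥ η, Σ ξᵢ = 1}`) whose fsl-extension
`h = FordMaynard.tweak (1/2) (41/250) ∅ ∅ F₀` (the tree's `tweak` with the EMPTY bad family) has `h 1 1 < −1` and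
`h k β ≥ −1` for all `k ≥ 2`  +  `memTypeIStar_tweak` (PROVED below from the tree's tweak apparatus:
`isSymmetric_tweak`, `tweak_support`, `exists_bound_tweak`, `isPiecewiseLipschitz_tweak`, `typeIIdentity_tweak` —
the fsl-extension of admissible raw data is a member of `𝔉*_η(γ)`).  The stub is STRICTLY STRONGER than the crux
(it fixes the witness shape and leaves two numerical inequalities about an explicit operator on step data: the
cell's certified LP optimum `fspec_41_250_m24.json`, `F₀(1) = −1.0044719185 ± 6.1e−11`, margin `4.5·10⁻³`,
kit j243625 / j244135) — not a restatement.  Inside the stub the prover's blocks are (i) small vectors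
(`fragOp_apply_of_small`: `h = F₀`, a rational table check), (ii) `k ≥ 2` with some `βⱼ ≥ 1/2`
(`fragOp_eq_multiSlice`: finitely many certified polylogarithmic cell integrals of `blockWeight (1/2)`),
(iii) `k = 1` (the same expansion of `h 1 1`, certified value `−1.00447`).  Proof class: ccert / kit (the LINE is kit 0).
-/

noncomputable section

open Literature.NumberTheory.Sieve Literature.NumberTheory.Sieve.FordMaynard

namespace Summit.Parity.GeneralizedHardyLittlewood.Cruxes.NegWitness0164.Birth

/-- Stub statement (the finite certificate on raw step data): some symmetric, piecewise-Lipschitz vector function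
`F₀` supported on `{ξᵢ ≥ 41/250, Σ ξᵢ = 1}` whose fsl-extension `h = tweak (1/2) (41/250) ∅ ∅ F₀` satisfies
`h(1) < −1` and `h ≥ −1` in all dimensions `≥ 2`. -/
def Signature.stub_tweakNeg0164 : Prop :=
  ∃ F₀ : VecFn, F₀.IsSymmetric ∧ (∀ k, IsPiecewiseLipschitz (F₀ k)) ∧
    (∀ (k : ℕ) (ξ : Fin k → ℝ), F₀ k ξ ≠ 0 → (∀ i, (41 / 250 : ℝ) ≤ ξ i) ∧ ∑ i, ξ i = 1) ∧
    tweak (1 / 2) (41 / 250) Fin.elim0 Fin.elim0 F₀ 1 (fun _ => 1) < -1 ∧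
    ∀ k : ℕ, 2 ≤ k → ∀ β : Fin k → ℝ, -1 ≤ tweak (1 / 2) (41 / 250) Fin.elim0 Fin.elim0 F₀ k β

/-- **The open stub** (XL, ccert class): the certificate, statement SPELLED OUT (definitionally
`Signature.stub_tweakNeg0164`, see the `example` below). -/
theorem stub_tweakNeg0164 :
    ∃ F₀ : VecFn, F₀.IsSymmetric ∧ (∀ k, IsPiecewiseLipschitz (F₀ k)) ∧
      (∀ (k : ℕ) (ξ : Fin k → ℝ), F₀ k ξ ≠ 0 → (∀ i, (41 / 250 : ℝ) ≤ ξ i) ∧ ∑ i, ξ i = 1) ∧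
      tweak (1 / 2) (41 / 250) Fin.elim0 Fin.elim0 F₀ 1 (fun _ => 1) < -1 ∧
      ∀ k : ℕ, 2 ≤ k → ∀ β : Fin k → ℝ, -1 ≤ tweak (1 / 2) (41 / 250) Fin.elim0 Fin.elim0 F₀ k β := by
  sorry

example : Signature.stub_tweakNeg0164 := stub_tweakNeg0164

/-- **The fsl-extension of admissible raw data is a member of `𝔉*_η(γ)`** (PROVED; the tree's `isSymmetric_tweak`,
`tweak_support`, `exists_bound_tweak`, `isPiecewiseLipschitz_tweak`, `typeIIdentity_tweak`). -/
theorem memTypeIStar_tweak {γ η : ℝ} (hγ0 : 0 < γ) (hγ1 : γ < 1) (hη0 : 0 < η) (hη1 : η ≤ 1)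
    {L : ℕ} (lo wd : Fin L → ℝ) {F₀ : VecFn} (hs : F₀.IsSymmetric) (hpl : ∀ k, IsPiecewiseLipschitz (F₀ k))
    (hsupp : ∀ (k : ℕ) (ξ : Fin k → ℝ), F₀ k ξ ≠ 0 → (∀ i, η ≤ ξ i) ∧ ∑ i, ξ i = 1) :
    MemTypeIStar η γ (tweak γ η lo wd F₀) := by
  obtain ⟨Hb, -, hHb⟩ := exists_bound_tweak (lo := lo) (wd := wd) hγ0 hγ1 hη0 hpl
  exact
    { symm := isSymmetric_tweak hs
      support := fun k ξ h => tweak_support h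
      bounded := ⟨Hb, hHb⟩
      piecewiseLipschitz := isPiecewiseLipschitz_tweak hγ0 hγ1 hη0 hpl
      typeI := typeIIdentity_tweak hγ0 hγ1 hη0 hη1 hs hpl hsupp }

/-- The extension step at `(η, γ) = (41/250, 1/2)` (PROVED instance of `memTypeIStar_tweak`). -/
theorem extension_0164 : ∀ F₀ : VecFn, F₀.IsSymmetric → (∀ k, IsPiecewiseLipschitz (F₀ k)) →
    (∀ (k : ℕ) (ξ : Fin k → ℝ), F₀ k ξ ≠ 0 → (∀ i, (41 / 250 : ℝ) ≤ ξ i) ∧ ∑ i, ξ i = 1) →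
    MemTypeIStar (41 / 250) (1 / 2) (tweak (1 / 2) (41 / 250) Fin.elim0 Fin.elim0 F₀) :=
  fun _F₀ hs hpl hsupp => memTypeIStar_tweak (by norm_num) (by norm_num) (by norm_num) (by norm_num) _ _ hs hpl hsupp

/-- **Composition (kernel-checked)**: the stub gives the ROUTE crux BY NAME, through the proved extension step. -/
theorem NegWitness0164_of :
    Signature.stub_tweakNeg0164 →
      Summit.Parity.GeneralizedHardyLittlewood.Theses.FordMaynardNoSieveConst0164.NegWitness0164 := by
  rintro ⟨F₀, hs, hpl, hsupp, hz, hlow⟩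
  exact ⟨_, extension_0164 F₀ hs hpl hsupp, hz, hlow⟩

/-- **The skeleton instantiated**: the crux BY NAME modulo the single registered stub (carries exactly its `sorry`). -/
theorem NegWitness0164_of_stubs :
    Summit.Parity.GeneralizedHardyLittlewood.Theses.FordMaynardNoSieveConst0164.NegWitness0164 :=
  NegWitness0164_of stub_tweakNeg0164

end Summit.Parity.GeneralizedHardyLittlewood.Cruxes.NegWitness0164.Birth

end
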